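import Mathlib
import Literature.Geometry.DiscreteGeometry.TwoShellPatterns

/-!
# The first shells of the two-shell patterns cover the sphere of directions
(stub S6 `stub_patternCovering` of crux `HullMinimality.LayeredWindows`, stmt-AtomisticToContinuum-11778,
line `registered`)

STATEMENT. For `P` the FCC or the HCP two-shell pattern (`fccTwoShellPattern`, `hcpTwoShellPattern`) and every
`u ∈ ℝ³` there is a UNIT vector `v ∈ P` with `⟪v, u⟫ ≥ (2/11)‖u‖`.

PROOF. It suffices to find `v` in the first shell (`fccKissingPattern ⊆ fccTwoShellPattern`,
`hcpKissingPattern ⊆ hcpTwoShellPattern`, both consisting of unit vectors).  The twelve first-shell vectors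
`v₁, …, v₁₂` of either pattern (cuboctahedron `(±1, ±1, 0)/√2` and permutations; anticuboctahedron
`hcpInt/√18`) satisfy `Σ_k v_k = 0` and `Σ_k ⟪v_k, u⟫² = 4‖u‖²` for all `u` (a tight frame): both are polynomial
identities in the coordinates of `u`, given `⟪r • (a, b, c), u⟫ = r (a u₀ + b u₁ + c u₂)` and
`‖u‖² = u₀² + u₁² + u₂²` (`EuclideanSpace.real_norm_sq_eq`).  If `⟪v_k, u⟫ < (2/11)‖u‖` for all `k`, then, as
`⟪v_k, u⟫ ≥ -‖u‖` (Cauchy–Schwarz), `(⟪v_k, u⟫ - (2/11)‖u‖)(⟪v_k, u⟫ + ‖u‖) ≤ 0` for each `k`; summing over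
`k` and using the two identities gives `4‖u‖² - (24/11)‖u‖² ≤ 0`, whereas summing the strict inequalities
gives `0 = Σ_k ⟪v_k, u⟫ < (24/11)‖u‖`, so `‖u‖ > 0` — a contradiction.  Everything is discharged by `linarith`
on the explicit coordinates.
-/

noncomputable section

open scoped BigOperators Classical InnerProductSpace

namespace Summit.AtomisticToContinuum.Crystallization.Theorems.LayeredWindowsLocal

open Literature.Geometry.DiscreteGeometry

local notation "E3" => EuclideanSpace ℝ (Fin 3)

namespace PatternCovering

/-- The inner product of a scaled integer vector `r • (a, b, c)` with `u`, in coordinates: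
`⟪r • (a, b, c), u⟫ = r (a u₀ + b u₁ + c u₂)`. -/
theorem inner_smul_intVec (r : ℝ) (a b c : ℤ) (u : E3) :
    ⟪r • intVec ![a, b, c], u⟫_ℝ = r * ((a : ℝ) * u 0 + (b : ℝ) * u 1 + (c : ℝ) * u 2) := by
  rw [real_inner_smul_left]
  congr 1
  simp [PiLp.inner_apply, Fin.sum_univ_three, intVec_apply]
  ring

/-- Cauchy–Schwarz lower bound for a unit vector: `⟪v, u⟫ ≥ -‖u‖`. -/
theorem neg_norm_le_inner_of_norm_eq_one {v : E3} (hv : ‖v‖ = 1) (u : E3) : -‖u‖ ≤ ⟪v, u⟫_ℝ := by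
  have h := abs_real_inner_le_norm v u
  rw [hv, one_mul] at h
  exact neg_le_of_abs_le h

/-- The scaled integer vectors of `fccInt` belong to the FCC kissing pattern. -/
theorem smul_intVec_mem_fccKissingPattern {z : Fin 3 → ℤ} (hz : z ∈ fccInt) :
    (Real.sqrt 2)⁻¹ • intVec z ∈ fccKissingPattern :=
  Finset.mem_image_of_mem _ hz

/-- The scaled integer vectors of `hcpInt` belong to the HCP kissing pattern. -/
theorem smul_intVec_mem_hcpKissingPattern {z : Fin 3 → ℤ} (hz : z ∈ hcpInt) :
    (Real.sqrt 18)⁻¹ • intVec z ∈ hcpKissingPattern :=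
  Finset.mem_image_of_mem _ hz

/-- **The cuboctahedron `2/11`-covers the sphere of directions**: for every `u ∈ ℝ³` some vector `v` of the
FCC kissing pattern has `⟪v, u⟫ ≥ (2/11)‖u‖` (frame identity `Σ_v ⟪v, u⟫² = 4‖u‖²` and `Σ_v v = 0`). -/
theorem exists_mem_fccKissingPattern_inner_ge (u : E3) :
    ∃ v ∈ fccKissingPattern, 2 / 11 * ‖u‖ ≤ ⟪v, u⟫_ℝ := by
  by_contra h
  push Not at h
  have hlt : ∀ z ∈ fccInt, ⟪(Real.sqrt 2)⁻¹ • intVec z, u⟫_ℝ < 2 / 11 * ‖u‖ := fun z hz =>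
    h _ (smul_intVec_mem_fccKissingPattern hz)
  have hprod : ∀ z ∈ fccInt, (⟪(Real.sqrt 2)⁻¹ • intVec z, u⟫_ℝ - 2 / 11 * ‖u‖) *
      (⟪(Real.sqrt 2)⁻¹ • intVec z, u⟫_ℝ + ‖u‖) ≤ 0 := by
    intro z hz
    have h1 := hlt z hz
    have h2 := neg_norm_le_inner_of_norm_eq_one
      (norm_eq_one_of_mem_fccKissingPattern (smul_intVec_mem_fccKissingPattern hz)) u
    exact mul_nonpos_of_nonpos_of_nonneg (by linarith) (by linarith)
  have l1 := hlt ![1, 1, 0] (by decide)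
  have l2 := hlt ![1, -1, 0] (by decide)
  have l3 := hlt ![-1, 1, 0] (by decide)
  have l4 := hlt ![-1, -1, 0] (by decide)
  have l5 := hlt ![1, 0, 1] (by decide)
  have l6 := hlt ![1, 0, -1] (by decide)
  have l7 := hlt ![-1, 0, 1] (by decide)
  have l8 := hlt ![-1, 0, -1] (by decide)
  have l9 := hlt ![0, 1, 1] (by decide)
  have l10 := hlt ![0, 1, -1] (by decide)
  have l11 := hlt ![0, -1, 1] (by decide)
  have l12 := hlt ![0, -1, -1] (by decide)
  have p1 := hprod ![1, 1, 0] (by decide)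
  have p2 := hprod ![1, -1, 0] (by decide)
  have p3 := hprod ![-1, 1, 0] (by decide)
  have p4 := hprod ![-1, -1, 0] (by decide)
  have p5 := hprod ![1, 0, 1] (by decide)
  have p6 := hprod ![1, 0, -1] (by decide)
  have p7 := hprod ![-1, 0, 1] (by decide)
  have p8 := hprod ![-1, 0, -1] (by decide)
  have p9 := hprod ![0, 1, 1] (by decide)
  have p10 := hprod ![0, 1, -1] (by decide)
  have p11 := hprod ![0, -1, 1] (by decide)
  have p12 := hprod ![0, -1, -1] (by decide)
  simp only [inner_smul_intVec] at l1 l2 l3 l4 l5 l6 l7 l8 l9 l10 l11 l12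
  simp only [inner_smul_intVec] at p1 p2 p3 p4 p5 p6 p7 p8 p9 p10 p11 p12
  push_cast at l1 l2 l3 l4 l5 l6 l7 l8 l9 l10 l11 l12
  push_cast at p1 p2 p3 p4 p5 p6 p7 p8 p9 p10 p11 p12
  have hs : (Real.sqrt 2)⁻¹ ^ 2 = (2 : ℝ)⁻¹ := by
    rw [inv_pow, Real.sq_sqrt (by norm_num)]
  have hkey : (Real.sqrt 2)⁻¹ ^ 2 * (u 0 ^ 2 + u 1 ^ 2 + u 2 ^ 2) = (2 : ℝ)⁻¹ * ‖u‖ ^ 2 := by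
    rw [hs, EuclideanSpace.real_norm_sq_eq u, Fin.sum_univ_three]
  have hpos : 0 < ‖u‖ := by linarith
  have hpos2 : 0 < ‖u‖ ^ 2 := by positivity
  linarith [p1, p2, p3, p4, p5, p6, p7, p8, p9, p10, p11, p12, hkey, hpos2]

/-- **The anticuboctahedron `2/11`-covers the sphere of directions**: for every `u ∈ ℝ³` some vector `v` of
the HCP kissing pattern has `⟪v, u⟫ ≥ (2/11)‖u‖` (frame identity `Σ_v ⟪v, u⟫² = 4‖u‖²` and `Σ_v v = 0`). -/
theorem exists_mem_hcpKissingPattern_inner_ge (u : E3) :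
    ∃ v ∈ hcpKissingPattern, 2 / 11 * ‖u‖ ≤ ⟪v, u⟫_ℝ := by
  by_contra h
  push Not at h
  have hlt : ∀ z ∈ hcpInt, ⟪(Real.sqrt 18)⁻¹ • intVec z, u⟫_ℝ < 2 / 11 * ‖u‖ := fun z hz =>
    h _ (smul_intVec_mem_hcpKissingPattern hz)
  have hprod : ∀ z ∈ hcpInt, (⟪(Real.sqrt 18)⁻¹ • intVec z, u⟫_ℝ - 2 / 11 * ‖u‖) *
      (⟪(Real.sqrt 18)⁻¹ • intVec z, u⟫_ℝ + ‖u‖) ≤ 0 := by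
    intro z hz
    have h1 := hlt z hz
    have h2 := neg_norm_le_inner_of_norm_eq_one
      (norm_eq_one_of_mem_hcpKissingPattern (smul_intVec_mem_hcpKissingPattern hz)) u
    exact mul_nonpos_of_nonpos_of_nonneg (by linarith) (by linarith)
  have l1 := hlt ![3, -3, 0] (by decide)
  have l2 := hlt ![-3, 3, 0] (by decide)
  have l3 := hlt ![3, 0, -3] (by decide)
  have l4 := hlt ![-3, 0, 3] (by decide)
  have l5 := hlt ![0, 3, -3] (by decide)
  have l6 := hlt ![0, -3, 3] (by decide)
  have l7 := hlt ![3, 3, 0] (by decide)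
  have l8 := hlt ![3, 0, 3] (by decide)
  have l9 := hlt ![0, 3, 3] (by decide)
  have l10 := hlt ![-1, -1, -4] (by decide)
  have l11 := hlt ![-1, -4, -1] (by decide)
  have l12 := hlt ![-4, -1, -1] (by decide)
  have p1 := hprod ![3, -3, 0] (by decide)
  have p2 := hprod ![-3, 3, 0] (by decide)
  have p3 := hprod ![3, 0, -3] (by decide)
  have p4 := hprod ![-3, 0, 3] (by decide)
  have p5 := hprod ![0, 3, -3] (by decide)
  have p6 := hprod ![0, -3, 3] (by decide)
  have p7 := hprod ![3, 3, 0] (by decide)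
  have p8 := hprod ![3, 0, 3] (by decide)
  have p9 := hprod ![0, 3, 3] (by decide)
  have p10 := hprod ![-1, -1, -4] (by decide)
  have p11 := hprod ![-1, -4, -1] (by decide)
  have p12 := hprod ![-4, -1, -1] (by decide)
  simp only [inner_smul_intVec] at l1 l2 l3 l4 l5 l6 l7 l8 l9 l10 l11 l12
  simp only [inner_smul_intVec] at p1 p2 p3 p4 p5 p6 p7 p8 p9 p10 p11 p12
  push_cast at l1 l2 l3 l4 l5 l6 l7 l8 l9 l10 l11 l12
  push_cast at p1 p2 p3 p4 p5 p6 p7 p8 p9 p10 p11 p12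
  have hs : (Real.sqrt 18)⁻¹ ^ 2 = (18 : ℝ)⁻¹ := by
    rw [inv_pow, Real.sq_sqrt (by norm_num)]
  have hkey : (Real.sqrt 18)⁻¹ ^ 2 * (u 0 ^ 2 + u 1 ^ 2 + u 2 ^ 2) = (18 : ℝ)⁻¹ * ‖u‖ ^ 2 := by
    rw [hs, EuclideanSpace.real_norm_sq_eq u, Fin.sum_univ_three]
  have hpos : 0 < ‖u‖ := by linarith
  have hpos2 : 0 < ‖u‖ ^ 2 := by positivity
  linarith [p1, p2, p3, p4, p5, p6, p7, p8, p9, p10, p11, p12, hkey, hpos2]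

end PatternCovering

/-- **Stub S6 `stub_patternCovering` (the first shells cover the sphere of directions).** For either two-shell
pattern and every vector `u` some UNIT pattern vector `v` has `⟪v, u⟫ ≥ (2/11)‖u‖` (the twelve first-shell vectors
sum to `0` and form a tight frame, `Σ_v ⟪v, u⟫² = 4‖u‖²`; if all `⟪v, u⟫ < (2/11)‖u‖` then
`Σ ⟪v, u⟫² ≤ (24/11)‖u‖² < 4‖u‖²`). -/
theorem stub_patternCovering :
    ∀ P : Finset E3, (P = fccTwoShellPattern ∨ P = hcpTwoShellPattern) → ∀ u : E3, ∃ v ∈ P, ‖v‖ = 1 ∧ 2 / 11 * ‖u‖ ≤ ⟪v, u⟫_ℝ := by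
  intro P hP u
  rcases hP with rfl | rfl
  · obtain ⟨v, hv, h⟩ := PatternCovering.exists_mem_fccKissingPattern_inner_ge u
    exact ⟨v, fccKissingPattern_subset hv, norm_eq_one_of_mem_fccKissingPattern hv, h⟩
  · obtain ⟨v, hv, h⟩ := PatternCovering.exists_mem_hcpKissingPattern_inner_ge u
    exact ⟨v, hcpKissingPattern_subset hv, norm_eq_one_of_mem_hcpKissingPattern hv, h⟩

end Summit.AtomisticToContinuum.Crystallization.Theorems.LayeredWindowsLocal

end
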